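import Summits.KontsevichZagierPeriods.Zeta5Search.LaiSweepShard

/-!
# `κ₃` sweep certificate — shard file 036 of 127 (shards 252–258 of 889)

HONEST FRAMING. Systematic search; no irrationality claim unless certified. This file only checks,
by `decide +kernel`, shards 252–258 of the order-cell sweep of the `κ₃` point `(74, 2180, 444; δ74)`
(engine `LaiSweepEngine`, soundness `LaiSweepJump/Free/Eval/Shard/Kappa3`; a shard is `⟨regime, n,
p, q, p', q', Lo, Up⟩`: `n` cells from `p/q` to `p'/q'` with integer rate sums in `[Lo, Up]`, `K =
128`, `D = 2^40`). It draws NO conclusion: only the capstone `LaiKappa3SweepCert`, which needs all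
127 shard files, does. Kernel cost of this file ≈ 560 cells × 0.3 s.
-/

namespace Summit.KontsevichZagierPeriods.Zeta5Search.Sweep

set_option maxHeartbeats 100000000 in
/-- Shard 252: 80 cells of regime B from `33/166` to `83/414`.
[cite: Lai2024BallRivoal, §4 Lemma 4.3] -/
theorem shard252 :
    Shard.check 128 (2^40)
      ⟨true, 80, 33, 166, 83, 414, 43823550729252, 45075525835944⟩ = true := by
  decide +kernel

set_option maxHeartbeats 100000000 in
/-- Shard 253: 80 cells of regime B from `83/414` to `55/273`.
[cite: Lai2024BallRivoal, §4 Lemma 4.3] -/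
theorem shard253 :
    Shard.check 128 (2^40)
      ⟨true, 80, 83, 414, 55, 273, 25458334839594, 26186015883853⟩ = true := by
  decide +kernel

set_option maxHeartbeats 100000000 in
/-- Shard 254: 80 cells of regime B from `55/273` to `76/375`.
[cite: Lai2024BallRivoal, §4 Lemma 4.3] -/
theorem shard254 :
    Shard.check 128 (2^40)
      ⟨true, 80, 55, 273, 76, 375, 30935382165930, 31831378708457⟩ = true := by
  decide +kernel

set_option maxHeartbeats 100000000 in
/-- Shard 255: 80 cells of regime B from `76/375` to `52/255`.
[cite: Lai2024BallRivoal, §4 Lemma 4.3] -/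
theorem shard255 :
    Shard.check 128 (2^40)
      ⟨true, 80, 76, 375, 52, 255, 32236152500264, 33183424164174⟩ = true := by
  decide +kernel

set_option maxHeartbeats 100000000 in
/-- Shard 256: 80 cells of regime B from `52/255` to `79/385`.
[cite: Lai2024BallRivoal, §4 Lemma 4.3] -/
theorem shard256 :
    Shard.check 128 (2^40)
      ⟨true, 80, 52, 255, 79, 385, 32475795905497, 33444435170443⟩ = true := by
  decide +kernel

set_option maxHeartbeats 100000000 in
/-- Shard 257: 80 cells of regime B from `79/385` to `58/281`.
[cite: Lai2024BallRivoal, §4 Lemma 4.3] -/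
theorem shard257 :
    Shard.check 128 (2^40)
      ⟨true, 80, 79, 385, 58, 281, 30737754916499, 31666945351973⟩ = true := by
  decide +kernel

set_option maxHeartbeats 100000000 in
/-- Shard 258: 80 cells of regime B from `58/281` to `65/313`.
[cite: Lai2024BallRivoal, §4 Lemma 4.3] -/
theorem shard258 :
    Shard.check 128 (2^40)
      ⟨true, 80, 58, 281, 65, 313, 31827391104867, 32803226597267⟩ = true := by
  decide +kernel

/-- The checked shards of this file, in order. [folklore] -/
def shards036 : List (CheckedShard 128 (2^40)) :=
  [⟨_, shard252⟩, ⟨_, shard253⟩, ⟨_, shard254⟩, ⟨_, shard255⟩, ⟨_, shard256⟩,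
    ⟨_, shard257⟩, ⟨_, shard258⟩]

end Summit.KontsevichZagierPeriods.Zeta5Search.Sweep
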